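import Summits.ResolutionOfSingularities.ResolutionOfSingularities.Theorems.EquisingularLiftEquisingularLiftNatVerticalCentre
import Summits.ResolutionOfSingularities.ResolutionOfSingularities.Theorems.EquisingularLiftCampaignW45bULTWeakOfNat
import Summits.ResolutionOfSingularities.ResolutionOfSingularities.Theorems.EquisingularLiftEquisingularLiftProjectiveAmbientSmoothProper
import Summits.ResolutionOfSingularities.ResolutionOfSingularities.Theorems.EquisingularLiftEquisingularLiftHorizResolutionBase
import Summits.ResolutionOfSingularities.ResolutionOfSingularities.Theorems.EquisingularLiftEquisingularLiftCentreBlowupSpecialFibreIntegral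
import Summits.ResolutionOfSingularities.ResolutionOfSingularities.Theorems.EquisingularLiftEquisingularLiftProjectiveAmbientIntegralFibre
import Literature.AlgebraicGeometry.Resolution.ProjectiveSpaceRegular
import Mathlib.AlgebraicGeometry.Morphisms.UniversallyOpen
import HarnessLib

/-!
# [OURS · L1 W4.5(b) · EL♮] `EquisingularLiftNat p → ULT p` — FIRST TOUCH with a HORIZONTAL centre
# (crux `EquisingularLiftNat` = stmt-ResolutionOfSingularities-20038; V-pack, final step)

HONEST FRAMING. OURS (cell res-hironaka, crux chain w45b, slot W4.5(b)); NOT a statement of any manuscript; AI-written,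
weaker than expert review. Helper `--supports stmt-ResolutionOfSingularities-20038 --as helper`. Plan of record:
L/w45b/CRUX-PLAN.md v3.0.1 §1.6 (ULT), L/w45b/EL-NATURAL/ULT-L0COMP-WORDS.md; typed target = res-L1-type-o1's
`Theorems.EquisingularLift.ULT` (`…CampaignW45bULT.lean`): ULTAt WITH the horizontality clause
`∃ c ∈ supp C, c ∉ (σ ≫ q)⁻¹{s₀} ∧ c ⤳ x′`.

THE ARGUMENT. Run the item's E1-closure on the invariant «(locally Noetherian ∧ quasi-compact) ∧ integral ∧ generic point
off the special fibre ∧ special fibre non-empty ∧ Y′ ⊆ special fibre ∧ no maximal point of the special fibre in closure Y′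
∧ (GOAL ∨ the special fibre has two maximal points ∨ (x-avoiding chain ∧ a non-regular point over x survives))». At the
END the special fibre is irreducible (second conclusion of the item) and the reduced strict transform regular (third), so
GOAL. At the FIRST TOUCH (a step whose centre meets the point over `x`) either some special fibre is reducible — it stays
reducible (`exists_two_maxPt_preimage_of_step`) — or both are irreducible, and then the centre has a HORIZONTAL generisation
at the touching point (`exists_horizontal_generization_of_isIrreducible`: Krull at a maximal point of the exceptional
Cartier divisor).

* `exists_horizontal_touching_centre_of_natChain` — general base `q : P → Spec O` (`P` integral Noetherian, generic point
  off the special fibre, `Y` inside the special fibre and off its maximal points).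
* `ult_of_equisingularLiftNat : EquisingularLiftNat p → ULT p` — THE OBJECT; the degenerate `H = ℙⁿ_k` (no point of `ℙⁿ_k`
  outside `range ι`) is excluded by `¬ IsRegularLocalRing 𝒪_{H,h}` via `isRegular_projectiveSpace`; the generic point of
  `ℙⁿ_O` is off the special fibre because `q` is smooth, hence universally open.
* `not_equisingularLiftNat_of_not_ultAt` — the disprover's exit: ONE instance `(k, n, H, ι, h)` with `¬ ULTAt` refutes
  `EquisingularLiftNat p` (o1's `not_equisingularLiftNat_of_not_ult` fed with the implication).

References: GW I Prop. 13.91 (3) [GortzWedhorn2020]; Krull; Stacks 01UA (flat + lfp ⇒ universally open), 02ND/02NS/02OS;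
tree files `…NatFirstTouch` (p500156), `…NatSpecialFibreMaxPoints` (p503337), `…NatVerticalCentre`, `…CampaignW45bULT`,
`…CampaignW45bULTWeakOfNat` (res-D-pv-003: bridge lemmas), `…CampaignW45bULTSpecialFibrePersists` (res-type-100:
`surjective_of_isBlowup`), `Literature…ProjectiveSpaceRegular`.
-/

set_option linter.dupNamespace false -- mandated namespace `Summit.<Summit>.<Problem>` of this single-conjunct summit
set_option linter.overlappingInstances false -- item signatures carry `[IsDomain O] [IsDiscreteValuationRing O]`

open CategoryTheory AlgebraicGeometry TopologicalSpace Topology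
open Literature.AlgebraicGeometry.Resolution
open AlgebraicGeometry.Scheme.IdealSheafData
open Summit.ResolutionOfSingularities.ResolutionOfSingularities.Theses.EquisingularLift.Split
open Summit.ResolutionOfSingularities.ResolutionOfSingularities.Cruxes.EquisingularLift.StrataSplit
open Summit.ResolutionOfSingularities.ResolutionOfSingularities.Theorems.EquisingularLift

namespace Summit.ResolutionOfSingularities.ResolutionOfSingularities.Cruxes.EquisingularLiftNat.Sections

/-! ## FIRST TOUCH with a horizontal centre (general base) -/

/-- **FIRST TOUCH with a HORIZONTAL centre (general base).** Let `O` be local, `P` an integral Noetherian scheme over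
`q : P → Spec O` whose generic point is off the special fibre, `Y` inside the special fibre containing no maximal point of
it, and `(P', σ, S')` in the E1-inductive closure of `(P, 𝟙, Y)` with irreducible LAST special fibre and regular
`V(closure S')`. Then every non-regular point `x ∈ Y` of `V(closure Y)` is touched, after an `x`-avoiding E1-chain, by a
regular centre `C₀ ∋ x₀ ↦ x` (E1, non-generic) having a generisation `c ⤳ x₀` inside `supp C₀` OFF the special fibre.
[folklore; GW I Prop. 13.91 (3), Krull] -/
theorem exists_horizontal_touching_centre_of_natChain {O : Type} [CommRing O] [IsLocalRing O]
    {P : AlgebraicGeometry.Scheme.{0}} [AlgebraicGeometry.IsIntegral P] [AlgebraicGeometry.IsLocallyNoetherian P]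
    [CompactSpace P] (q : P ⟶ AlgebraicGeometry.Spec (.of O)) (Y : Set P) {P' : AlgebraicGeometry.Scheme.{0}}
    (σ : P' ⟶ P) (S' : Set P')
    (hch : (∀ Q : (∀ X' : AlgebraicGeometry.Scheme.{0}, (X' ⟶ P) → Set X' → Prop), Q P (CategoryTheory.CategoryStruct.id _) Y → (∀ (X' X'' : AlgebraicGeometry.Scheme.{0}) (σ' : X' ⟶ P) (Y' : Set X') (C : X'.IdealSheafData) (τ : X'' ⟶ X'), Q X' σ' Y' → Literature.AlgebraicGeometry.Resolution.IsBlowup τ C → Literature.AlgebraicGeometry.Resolution.Scheme.IsRegular C.subscheme → σ' '' (C.support : Set X') ⊆ {x | ¬ IsGenericPoint x Y} → (C.support : Set X') ∩ (CategoryTheory.CategoryStruct.comp σ' q) ⁻¹' {IsLocalRing.closedPoint O} ⊆ Y' → Q X'' (CategoryTheory.CategoryStruct.comp τ σ') (closure (τ ⁻¹' (Y' \ (C.support : Set X'))))) → Q P' σ S'))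
    (hirr : IsIrreducible ((CategoryTheory.CategoryStruct.comp σ q) ⁻¹' {IsLocalRing.closedPoint O}))
    (hreg : Literature.AlgebraicGeometry.Resolution.Scheme.IsRegular (AlgebraicGeometry.Scheme.IdealSheafData.vanishingIdeal (⟨closure S', isClosed_closure⟩ : TopologicalSpace.Closeds P')).subscheme)
    (hgenP : ∀ ξ : P, IsGenericPoint ξ (Set.univ : Set P) → ξ ∉ q ⁻¹' {IsLocalRing.closedPoint O})
    (hYF : Y ⊆ q ⁻¹' {IsLocalRing.closedPoint O})
    (hNM : ∀ w : P, (w ∈ q ⁻¹' {IsLocalRing.closedPoint O} ∧ ∀ y ∈ q ⁻¹' {IsLocalRing.closedPoint O}, y ⤳ w → y = w) →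
      w ∉ closure Y)
    {x : P} (hxY : x ∈ Y) (hx : (∃ w : ↥(AlgebraicGeometry.Scheme.IdealSheafData.vanishingIdeal (⟨closure Y, isClosed_closure⟩ : TopologicalSpace.Closeds P)).subscheme, (AlgebraicGeometry.Scheme.IdealSheafData.vanishingIdeal (⟨closure Y, isClosed_closure⟩ : TopologicalSpace.Closeds P)).subschemeι w = x ∧ ¬ IsRegularLocalRing ((AlgebraicGeometry.Scheme.IdealSheafData.vanishingIdeal (⟨closure Y, isClosed_closure⟩ : TopologicalSpace.Closeds P)).subscheme.presheaf.stalk w))) :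
    ∃ (X₀ : AlgebraicGeometry.Scheme.{0}) (σ₀ : X₀ ⟶ P) (Y₀ : Set X₀), (∀ Q : (∀ X' : AlgebraicGeometry.Scheme.{0}, (X' ⟶ P) → Set X' → Prop), Q P (CategoryTheory.CategoryStruct.id _) Y → (∀ (X' X'' : AlgebraicGeometry.Scheme.{0}) (σ' : X' ⟶ P) (Y' : Set X') (C : X'.IdealSheafData) (τ : X'' ⟶ X'), Q X' σ' Y' → Literature.AlgebraicGeometry.Resolution.IsBlowup τ C → Literature.AlgebraicGeometry.Resolution.Scheme.IsRegular C.subscheme → σ' '' (C.support : Set X') ⊆ {x | ¬ IsGenericPoint x Y} → (C.support : Set X') ∩ (CategoryTheory.CategoryStruct.comp σ' q) ⁻¹' {IsLocalRing.closedPoint O} ⊆ Y' → x ∉ σ' '' (C.support : Set X') → Q X'' (CategoryTheory.CategoryStruct.comp τ σ') (closure (τ ⁻¹' (Y' \ (C.support : Set X'))))) → Q X₀ σ₀ Y₀) ∧ ∃ C₀ : X₀.IdealSheafData, Literature.AlgebraicGeometry.Resolution.Scheme.IsRegular C₀.subscheme ∧ (∃ x₀ : X₀, x₀ ∈ (C₀.support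 : Set X₀) ∧ σ₀ x₀ = x ∧ ∃ c : X₀, c ∈ (C₀.support : Set X₀) ∧ c ∉ (CategoryTheory.CategoryStruct.comp σ₀ q) ⁻¹' {IsLocalRing.closedPoint O} ∧ c ⤳ x₀) ∧ (C₀.support : Set X₀) ∩ (CategoryTheory.CategoryStruct.comp σ₀ q) ⁻¹' {IsLocalRing.closedPoint O} ⊆ Y₀ ∧ σ₀ '' (C₀.support : Set X₀) ⊆ {x | ¬ IsGenericPoint x Y} := by
  -- local abbreviations
  let F : ∀ X' : Scheme.{0}, (X' ⟶ P) → Set X' := fun X' σ' =>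
    (CategoryTheory.CategoryStruct.comp σ' q) ⁻¹' {IsLocalRing.closedPoint O}
  let MP : ∀ X' : Scheme.{0}, Set X' → X' → Prop := fun X' F w => w ∈ F ∧ ∀ y ∈ F, y ⤳ w → y = w
  let RED : ∀ X' : Scheme.{0}, (X' ⟶ P) → Prop := fun X' σ' =>
    ∃ w₁ w₂ : X', MP X' (F X' σ') w₁ ∧ MP X' (F X' σ') w₂ ∧ w₁ ≠ w₂
  let NM : ∀ X' : Scheme.{0}, (X' ⟶ P) → Set X' → Prop := fun X' σ' Y' =>
    ∀ w : X', MP X' (F X' σ') w → w ∉ closure Y'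
  let AV : ∀ X' : Scheme.{0}, (X' ⟶ P) → Set X' → Prop := fun X₀ σ₀ Y₀ =>
    (∀ Q : (∀ X' : AlgebraicGeometry.Scheme.{0}, (X' ⟶ P) → Set X' → Prop), Q P (CategoryTheory.CategoryStruct.id _) Y → (∀ (X' X'' : AlgebraicGeometry.Scheme.{0}) (σ' : X' ⟶ P) (Y' : Set X') (C : X'.IdealSheafData) (τ : X'' ⟶ X'), Q X' σ' Y' → Literature.AlgebraicGeometry.Resolution.IsBlowup τ C → Literature.AlgebraicGeometry.Resolution.Scheme.IsRegular C.subscheme → σ' '' (C.support : Set X') ⊆ {x | ¬ IsGenericPoint x Y} → (C.support : Set X') ∩ (CategoryTheory.CategoryStruct.comp σ' q) ⁻¹' {IsLocalRing.closedPoint O} ⊆ Y' → x ∉ σ' '' (C.support : Set X') → Q X'' (CategoryTheory.CategoryStruct.comp τ σ') (closure (τ ⁻¹' (Y' \ (C.support : Set X'))))) → Q X₀ σ₀ Y₀)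
  let NR : ∀ X' : Scheme.{0}, (X' ⟶ P) → Set X' → Prop := fun X' σ' Y' =>
    ∃ x' : X', x' ∈ Y' ∧ σ' x' = x ∧ (∃ w : ↥(AlgebraicGeometry.Scheme.IdealSheafData.vanishingIdeal (⟨closure Y', isClosed_closure⟩ : TopologicalSpace.Closeds X')).subscheme, (AlgebraicGeometry.Scheme.IdealSheafData.vanishingIdeal (⟨closure Y', isClosed_closure⟩ : TopologicalSpace.Closeds X')).subschemeι w = x' ∧ ¬ IsRegularLocalRing ((AlgebraicGeometry.Scheme.IdealSheafData.vanishingIdeal (⟨closure Y', isClosed_closure⟩ : TopologicalSpace.Closeds X')).subscheme.presheaf.stalk w))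
  have hFcl : ∀ (X' : Scheme.{0}) (σ' : X' ⟶ P), IsClosed (F X' σ') := fun X' σ' =>
    (IsLocalRing.isClosed_singleton_closedPoint O).preimage (CategoryTheory.CategoryStruct.comp σ' q).base.hom.continuous
  have hFstep : ∀ (X' X'' : Scheme.{0}) (σ' : X' ⟶ P) (τ : X'' ⟶ X'),
      F X'' (CategoryTheory.CategoryStruct.comp τ σ') = τ ⁻¹' F X' σ' := by
    intro X' X'' σ' τ
    ext v
    simp only [F, Set.mem_preimage, Scheme.Hom.comp_apply]
  -- run the E1-closure
  have key := hch (fun X' σ' Y' => ((IsLocallyNoetherian X' ∧ CompactSpace X') ∧ IsIntegral X' ∧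
      (∀ ξ : X', IsGenericPoint ξ (Set.univ : Set X') → ξ ∉ F X' σ') ∧ (F X' σ').Nonempty ∧ Y' ⊆ F X' σ' ∧
      NM X' σ' Y') ∧
      ((∃ (X₀ : AlgebraicGeometry.Scheme.{0}) (σ₀ : X₀ ⟶ P) (Y₀ : Set X₀), (∀ Q : (∀ X' : AlgebraicGeometry.Scheme.{0}, (X' ⟶ P) → Set X' → Prop), Q P (CategoryTheory.CategoryStruct.id _) Y → (∀ (X' X'' : AlgebraicGeometry.Scheme.{0}) (σ' : X' ⟶ P) (Y' : Set X') (C : X'.IdealSheafData) (τ : X'' ⟶ X'), Q X' σ' Y' → Literature.AlgebraicGeometry.Resolution.IsBlowup τ C → Literature.AlgebraicGeometry.Resolution.Scheme.IsRegular C.subscheme → σ' '' (C.support : Set X') ⊆ {x | ¬ IsGenericPoint x Y} → (C.support : Set X') ∩ (CategoryTheory.CategoryStruct.comp σ' q) ⁻¹' {IsLocalRing.closedPoint O} ⊆ Y' → x ∉ σ' '' (C.support : Set X') → Q X'' (CategoryTheory.CategoryStruct.comp τ σ') (closure (τ ⁻¹' (Y' \ (C.support : Set X'))))) → Q X₀ σ₀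 Y₀) ∧ ∃ C₀ : X₀.IdealSheafData, Literature.AlgebraicGeometry.Resolution.Scheme.IsRegular C₀.subscheme ∧ (∃ x₀ : X₀, x₀ ∈ (C₀.support : Set X₀) ∧ σ₀ x₀ = x ∧ ∃ c : X₀, c ∈ (C₀.support : Set X₀) ∧ c ∉ (CategoryTheory.CategoryStruct.comp σ₀ q) ⁻¹' {IsLocalRing.closedPoint O} ∧ c ⤳ x₀) ∧ (C₀.support : Set X₀) ∩ (CategoryTheory.CategoryStruct.comp σ₀ q) ⁻¹' {IsLocalRing.closedPoint O} ⊆ Y₀ ∧ σ₀ '' (C₀.support : Set X₀) ⊆ {x | ¬ IsGenericPoint x Y}) ∨ RED X' σ' ∨ (AV X' σ' Y' ∧ NR X' σ' Y'))) ?_ ?_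
  · obtain ⟨-, hG | hred | ⟨-, x', -, -, w, -, hw⟩⟩ := key
    · exact hG
    · obtain ⟨w₁, w₂, hw₁, hw₂, hne⟩ := hred
      exact absurd (maxPt_unique_of_isIrreducible hirr (hFcl P' σ) hw₁ hw₂) hne
    · exact absurd (hreg w) hw
  · -- base
    refine ⟨⟨⟨inferInstance, inferInstance⟩, inferInstance, ?_, ?_, ?_, ?_⟩,
      Or.inr (Or.inr ⟨fun Q h0 _ => h0, x, hxY, by simp, hx⟩)⟩
    · simpa [F] using hgenP
    · exact ⟨x, by simpa [F] using hYF hxY⟩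
    · simpa [F] using hYF
    · simpa [NM, MP, F] using hNM
  · intro X' X'' σ' Y' C τ hQ hbl hC hgen hE1
    obtain ⟨⟨⟨hN', hc'⟩, hint, hgen', hne', hSF, hnm⟩, hQ⟩ := hQ
    haveI := hN'
    haveI := hc'
    haveI := hint
    haveI : IsProper τ := hbl.isProper
    haveI : IsLocallyNoetherian X'' := LocallyOfFiniteType.isLocallyNoetherian τ
    haveI : CompactSpace X'' := QuasiCompact.compactSpace_of_compactSpace τ
    haveI : AlgebraicGeometry.IsNoetherian X'' := AlgebraicGeometry.IsNoetherian.mk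
    have hF'' : F X'' (CategoryTheory.CategoryStruct.comp τ σ') = τ ⁻¹' F X' σ' := hFstep X' X'' σ' τ
    -- maximal points of the special fibre are off the centre
    have hNMC : ∀ w, MP X' (F X' σ') w → w ∉ (C.support : Set X') := fun w hw hwC =>
      hnm w hw (subset_closure (hE1 ⟨hwC, hw.1⟩))
    -- the centre is a genuine ideal sheaf
    have hC0 : C ≠ ⊥ := by
      rintro rfl
      obtain ⟨v, hv⟩ := hne'
      obtain ⟨m, hm, -⟩ := exists_maxPt_specializes (hFcl X' σ') hv
      apply hNMC m hm
      rw [Scheme.IdealSheafData.support_bot]; trivial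
    haveI : IsIntegral X'' := hbl.isIntegral hC0
    have hsurj : Function.Surjective τ := surjective_of_isBlowup hbl hC0
    -- persistence of the structural invariants
    have hgenX' : genericPoint X' ∉ F X' σ' := hgen' _ (genericPoint_spec X')
    have hgen'' : ∀ ξ : X'', IsGenericPoint ξ (Set.univ : Set X'') →
        ξ ∉ F X'' (CategoryTheory.CategoryStruct.comp τ σ') := by
      intro ξ hξ
      rw [hF'']
      have hτξ : IsGenericPoint (τ ξ) (Set.univ : Set X') := by
        have h1 := hξ.image τ.base.hom.continuous
        rwa [Set.image_univ, hsurj.range_eq, closure_univ] at h1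
      show τ ξ ∉ F X' σ'
      exact hgen' _ hτξ
    have hne'' : (F X'' (CategoryTheory.CategoryStruct.comp τ σ')).Nonempty := by
      obtain ⟨v, hv⟩ := hne'
      obtain ⟨m, hm, -⟩ := exists_maxPt_specializes (hFcl X' σ') hv
      obtain ⟨m'', hm'', -, -⟩ := exists_maxPt_preimage_of_step τ C hbl (F X' σ') hm (hNMC m hm)
      exact ⟨m'', by rw [hF'']; show τ m'' ∈ F X' σ'; rw [hm'']; exact hm.1⟩
    have hSF'' : closure (τ ⁻¹' (Y' \ (C.support : Set X'))) ⊆ F X'' (CategoryTheory.CategoryStruct.comp τ σ') := by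
      rw [hF'']
      exact closure_minimal (fun v ⟨hv, _⟩ => hSF hv) ((hFcl X' σ').preimage τ.base.hom.continuous)
    have hnm'' : NM X'' (CategoryTheory.CategoryStruct.comp τ σ') (closure (τ ⁻¹' (Y' \ (C.support : Set X')))) := by
      intro w hw
      rw [hF''] at hw
      exact maxPt_not_mem_strictTransform_of_step τ C hbl (F X' σ') (hFcl X' σ') Y' hSF hnm w hw
    have hredstep : RED X' σ' → RED X'' (CategoryTheory.CategoryStruct.comp τ σ') := by
      intro hred
      obtain ⟨v₁, v₂, hv₁, hv₂, hne⟩ := exists_two_maxPt_preimage_of_step τ C hbl (F X' σ') hNMC hred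
      refine ⟨v₁, v₂, ?_, ?_, hne⟩
      · rw [hF'']; exact hv₁
      · rw [hF'']; exact hv₂
    refine ⟨⟨⟨inferInstance, inferInstance⟩, inferInstance, hgen'', hne'', hSF'', hnm''⟩, ?_⟩
    rcases hQ with hG | hred | ⟨hav, x', hx'Y, hx'x, w, hw, hwreg⟩
    · exact Or.inl hG
    · exact Or.inr (Or.inl (hredstep hred))
    · by_cases hxc : x ∈ σ' '' (C.support : Set X')
      · -- FIRST TOUCH
        by_cases hred : RED X' σ' ∨ RED X'' (CategoryTheory.CategoryStruct.comp τ σ')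
        · rcases hred with h | h
          · exact Or.inr (Or.inl (hredstep h))
          · exact Or.inr (Or.inl h)
        · push Not at hred
          obtain ⟨hred', hred''⟩ := hred
          have huniq' : ∀ w₁ w₂, MP X' (F X' σ') w₁ → MP X' (F X' σ') w₂ → w₁ = w₂ := by
            intro w₁ w₂ h₁ h₂; by_contra hne; exact hred' ⟨w₁, w₂, h₁, h₂, hne⟩
          have huniq'' : ∀ w₁ w₂, MP X'' (F X'' (CategoryTheory.CategoryStruct.comp τ σ')) w₁ →
              MP X'' (F X'' (CategoryTheory.CategoryStruct.comp τ σ')) w₂ → w₁ = w₂ := by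
            intro w₁ w₂ h₁ h₂; by_contra hne; exact hred'' ⟨w₁, w₂, h₁, h₂, hne⟩
          have hirr' : IsIrreducible (F X' σ') := isIrreducible_of_maxPt_unique (hFcl X' σ') hne' huniq'
          have hirr'' : IsIrreducible (τ ⁻¹' F X' σ') := by
            rw [← hF'']
            exact isIrreducible_of_maxPt_unique (hFcl X'' _) hne'' huniq''
          -- the generic point of the special fibre is off the centre
          obtain ⟨ζ, hζ⟩ := QuasiSober.sober hirr' (hFcl X' σ')
          have hζmax : MP X' (F X' σ') ζ := ⟨hζ.mem, fun y hy hyζ => ((hζ.specializes hy).antisymm hyζ).eq.symm⟩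
          have hζC : ζ ∉ (C.support : Set X') := hNMC ζ hζmax
          obtain ⟨x₀, hx₀, hx₀x⟩ := hxc
          obtain ⟨c, hc, hcF, hcx₀⟩ := exists_horizontal_generization_of_isIrreducible τ C hbl hC0 (F X' σ')
            (hFcl X' σ') hgenX' hζ hζC hirr'' hx₀
          exact Or.inl ⟨X', σ', Y', hav, C, hC, ⟨x₀, hx₀, hx₀x, c, hc, hcF, hcx₀⟩, hE1, hgen⟩
      · -- the centre misses `x`
        refine Or.inr (Or.inr ⟨fun Q h0 hs => hs X' X'' σ' Y' C τ (hav Q h0 hs) hbl hC hgen hE1 hxc, ?_⟩)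
        have hx'C : x' ∉ (C.support : Set X') := fun h => hxc ⟨x', h, hx'x⟩
        obtain ⟨x'', hx'', hmem, z, hz, hzreg⟩ := nonregular_point_persists τ C hbl Y' hx'Y hx'C w hw hwreg
        refine ⟨x'', hmem, ?_, z, hz, hzreg⟩
        rw [Scheme.Hom.comp_apply, hx'', hx'x]

/-! ## THE OBJECT: `EquisingularLiftNat p → ULT p` -/

/-- **[OURS · L1 W4.5(b)] `EquisingularLiftNat p → ULT p`** (first touch + lemma V). If the item EL♮ holds at the prime
`p`, then for every instance `(k, n, H, ι)` of the item and every point `h` of `H` with non-regular local ring (binder (B);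
«`h` not closed» is not used), for the `O, π` the item provides and every `φ, Y` as in the item: there are a stage
`(P′, σ, S′)` in the inductive closure of `(ℙⁿ_O, 𝟙, Y)` under E1-steps AVOIDING `x := (ι ≫ Proj.map φ) h`, and an ideal
sheaf `C` on `P′` with `V(C)` regular, a point `x′ ∈ supp C` over `x` admitting a generisation `c ∈ supp C` OFF the
special fibre (HORIZONTALITY), `supp C ∩ (σ ≫ q)⁻¹{s₀} ⊆ closure S′` (E1) and `σ(supp C)` off the generic points of `Y`.
Ingredients: `exists_horizontal_touching_centre_of_natChain`; the base facts for `ℙⁿ_O` (integral: `Proj.isIntegral`;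
Noetherian: `q` proper over `Spec O`; generic point off the special fibre: `q` smooth ⇒ universally open; special fibre
irreducible: `isIntegral_specialFibre_projectiveSpace`; `Y` closed inside the special fibre and `≠` it: a point of `ℙⁿ_k`
outside `range ι` exists because `𝒪_{H,h}` is not regular while `ℙⁿ_k` is regular); res-D-pv-003's bridge
`exists_vanishingIdeal_witness_of_not_isRegularLocalRing`. Replaces the role of NOTHING in the manuscript; NOT a statement
of the manuscript. [folklore] -/
theorem ult_of_equisingularLiftNat {p : ℕ}
    (hE : Summit.ResolutionOfSingularities.ResolutionOfSingularities.Theorems.EquisingularLiftNat p) :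
    ULT p := by
  intro hp k _ _ _ n H ι hι hH hloc h hreg _
  obtain ⟨O, i1, i2, i3, i4, π, hπ, h'⟩ := hE hp k n H ι hι hH hloc
  refine ⟨O, i1, i2, i3, i4, π, hπ, ?_⟩
  letI := MvPolynomial.gradedAlgebra (σ := Fin (n + 1)) (R := O)
  letI := MvPolynomial.gradedAlgebra (σ := Fin (n + 1)) (R := k)
  intro φ hφ' hφ Y hY
  haveI := hH
  obtain ⟨P', σ, S', hchain, hirr, hregS⟩ := h' φ hφ' hφ Y hY
  -- the base `q : ℙⁿ_O → Spec O`
  set q : Proj (MvPolynomial.homogeneousSubmodule (Fin (n + 1)) O) ⟶ Spec (.of O) :=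
    Proj.toSpecZero (MvPolynomial.homogeneousSubmodule (Fin (n + 1)) O) ≫
      Spec.map (CommRingCat.ofHom (algebraMap O (MvPolynomial.homogeneousSubmodule (Fin (n + 1)) O 0))) with hq
  obtain ⟨hsm, hprop⟩ := stub_projectiveAmbientSmoothProper O n
  haveI : IsProper q := hprop
  haveI : Smooth q := hsm
  haveI : IsNoetherianRing (CommRingCat.of O) := inferInstanceAs (IsNoetherianRing O)
  haveI : IsDomain (CommRingCat.of O) := inferInstanceAs (IsDomain O)
  haveI : IsLocallyNoetherian (Proj (MvPolynomial.homogeneousSubmodule (Fin (n + 1)) O)) :=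
    LocallyOfFiniteType.isLocallyNoetherian q
  haveI : CompactSpace ↥(Proj (MvPolynomial.homogeneousSubmodule (Fin (n + 1)) O)) :=
    QuasiCompact.compactSpace_of_compactSpace q
  haveI : IsIntegral (Proj (MvPolynomial.homogeneousSubmodule (Fin (n + 1)) O)) :=
    Proj.isIntegral _ (irrelevant_homogeneousSubmodule_ne_bot n O)
  -- the comparison `g : ℙⁿ_k → ℙⁿ_O`, a closed immersion onto the special fibre
  set g : Proj (MvPolynomial.homogeneousSubmodule (Fin (n + 1)) k) ⟶
      Proj (MvPolynomial.homogeneousSubmodule (Fin (n + 1)) O) := Proj.map φ hφ' with hg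
  have hP := ProjectiveAmbientFibre.isPullback_projMap π φ hφ hπ hφ'
  haveI : IsClosedImmersion (Spec.map (CommRingCat.ofHom π)) := IsClosedImmersion.spec_of_surjective _ hπ
  haveI hgci : IsClosedImmersion g := MorphismProperty.IsStableUnderBaseChange.of_isPullback hP.flip inferInstance
  have hpt : ∀ z : Spec (.of k), Spec.map (CommRingCat.ofHom π) z = IsLocalRing.closedPoint O := by
    intro z
    rw [Spec.map_apply]
    apply PrimeSpectrum.ext
    rw [PrimeSpectrum.comap_asIdeal, CommRingCat.hom_ofHom, Ideal.eq_bot_of_prime z.asIdeal, ← RingHom.ker_eq_comap_bot]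
    exact IsLocalRing.eq_maximalIdeal (RingHom.ker_isMaximal_of_surjective π hπ)
  have hgq : ∀ z, q (g z) = IsLocalRing.closedPoint O := fun z ↦
    (Scheme.Hom.comp_apply g q z).symm.trans
      ((congrArg (fun h : Proj (MvPolynomial.homogeneousSubmodule (Fin (n + 1)) k) ⟶ Spec (.of O) ↦ h z) hP.w).trans
        ((Scheme.Hom.comp_apply _ _ z).trans (hpt _)))
  -- `ι` as a closed immersion into `Proj k[x]`
  let ι' : H ⟶ Proj (MvPolynomial.homogeneousSubmodule (Fin (n + 1)) k) := ι
  haveI : IsClosedImmersion ι' := hι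
  have hYF : Y ⊆ q ⁻¹' {IsLocalRing.closedPoint O} := by
    rw [hY]
    rintro _ ⟨a, rfl⟩
    show q ((ι ≫ g) a) = IsLocalRing.closedPoint O
    rw [Scheme.Hom.comp_apply]
    exact hgq (ι a)
  have hYcl : IsClosed Y := by rw [hY]; exact (ι' ≫ g).isClosedEmbedding.isClosed_range
  -- a point of `ℙⁿ_k` outside `range ι` (else `H ≅ ℙⁿ_k` would be regular at `h`)
  have hH' : ∃ z : Proj (MvPolynomial.homogeneousSubmodule (Fin (n + 1)) k), z ∉ Set.range ι' := by
    by_contra hall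
    push Not at hall
    have hrange : Set.range (𝟙 (Proj (MvPolynomial.homogeneousSubmodule (Fin (n + 1)) k))) = Set.range ι' := by
      ext z; simpa using hall z
    haveI : IsIntegral (Proj (MvPolynomial.homogeneousSubmodule (Fin (n + 1)) k)) :=
      isIntegral_proj_homogeneousSubmodule n k
    have hregP : IsRegularLocalRing ((Proj (MvPolynomial.homogeneousSubmodule (Fin (n + 1)) k)).presheaf.stalk (ι' h)) :=
      isRegular_projectiveSpace n k (ι' h)
    exact hreg ((isRegularLocalRing_stalk_iff_of_range_eq (𝟙 _) ι' hrange (a₁ := ι' h) (a₂ := h) (by simp)).mpr hregP)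
  -- no maximal point of the (irreducible) special fibre lies in `closure Y = Y`
  have hirrP : IsIrreducible (q ⁻¹' {IsLocalRing.closedPoint O}) := by
    haveI := isIntegral_specialFibre_projectiveSpace O n
    exact isIrreducible_preimage_closedPoint O _ q
  have hNM : ∀ w, (w ∈ q ⁻¹' {IsLocalRing.closedPoint O} ∧
      ∀ y ∈ q ⁻¹' {IsLocalRing.closedPoint O}, y ⤳ w → y = w) → w ∉ closure Y := by
    intro w hw hwY
    obtain ⟨ζ, hζ⟩ := QuasiSober.sober hirrP
      ((IsLocalRing.isClosed_singleton_closedPoint O).preimage q.base.hom.continuous)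
    have hζw : ζ = w := hw.2 ζ hζ.mem (hζ.specializes hw.1)
    rw [hYcl.closure_eq] at hwY
    have hFY : q ⁻¹' {IsLocalRing.closedPoint O} ⊆ Y := by
      rw [← hζ.def, hζw]
      exact closure_minimal (Set.singleton_subset_iff.mpr hwY) hYcl
    obtain ⟨z, hz⟩ := hH'
    have hgz : g z ∈ Y := hFY (hgq z)
    rw [hY] at hgz
    obtain ⟨a, ha⟩ := hgz
    rw [Scheme.Hom.comp_apply] at ha
    exact hz ⟨a, g.isClosedEmbedding.injective ha⟩
  -- the generic point of `ℙⁿ_O` is off the special fibre: `q` is smooth, hence (universally) open, so its image is an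
  -- open non-empty subset of `Spec O` and contains the generic point, which is not the closed point of the DVR `O`
  have hgenP : ∀ ξ : Proj (MvPolynomial.homogeneousSubmodule (Fin (n + 1)) O),
      IsGenericPoint ξ (Set.univ : Set (Proj (MvPolynomial.homogeneousSubmodule (Fin (n + 1)) O))) →
        ξ ∉ q ⁻¹' {IsLocalRing.closedPoint O} := by
    intro ξ hξ hξF
    have hopen : IsOpen (Set.range q) := by
      rw [← Set.image_univ]; exact q.isOpenMap _ isOpen_univ
    have hne : (Set.range q).Nonempty := ⟨q ξ, ξ, rfl⟩
    have hgen : genericPoint (Spec (.of O)) ∈ Set.range q := by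
      rw [(genericPoint_spec (Spec (.of O))).mem_open_set_iff hopen]
      simpa using hne
    obtain ⟨p₀, hp₀⟩ := hgen
    have hp₀F : p₀ ∈ q ⁻¹' {IsLocalRing.closedPoint O} := by
      have hF : q ⁻¹' {IsLocalRing.closedPoint O} = Set.univ := by
        apply Set.eq_univ_of_univ_subset
        rw [← hξ.def]
        exact closure_minimal (Set.singleton_subset_iff.mpr hξF)
          ((IsLocalRing.isClosed_singleton_closedPoint O).preimage q.base.hom.continuous)
      rw [hF]; trivial
    have h1 : genericPoint (Spec (.of O)) = IsLocalRing.closedPoint O := hp₀.symm.trans hp₀F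
    rw [genericPoint_eq_bot_of_affine] at h1
    have h2 := congrArg PrimeSpectrum.asIdeal h1
    exact IsDiscreteValuationRing.not_a_field O h2.symm
  -- the non-regular point of `V(closure Y)` over `x := (ι ≫ g) h` (pv-003's bridge)
  have hci := @IsClosedImmersion.comp _ _ _ ι _ hι hgci
  have hx := @exists_vanishingIdeal_witness_of_not_isRegularLocalRing _ _ _ hci inferInstance _ hreg
  subst hY
  obtain ⟨X₀, σ₀, Y₀, hav, C₀, hC, hpt', hE1, hgen⟩ :=
    exists_horizontal_touching_centre_of_natChain q _ σ S' hchain hirr hregS hgenP hYF hNM ⟨h, rfl⟩ hx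
  exact ⟨X₀, σ₀, Y₀, hav, C₀, hC, hpt', hE1.trans subset_closure, hgen⟩

/-- **The disprover's exit (with horizontality).** ONE instance `(k, n, H, ι, h)` satisfying binder (B) with `¬ ULTAt`
refutes the item `EquisingularLiftNat p` (o1's `not_equisingularLiftNat_of_not_ult` fed with `ult_of_equisingularLiftNat`).
[folklore] -/
theorem not_equisingularLiftNat_of_not_ultAt {p : ℕ} (hp : p.Prime) {k : Type} [Field k] [CharP k p]
    [IsAlgClosed k] {n : ℕ} {H : AlgebraicGeometry.Scheme.{0}}
    {ι : H ⟶ (Literature.AlgebraicGeometry.Motives.projectiveSpace n k).left}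
    (hι : AlgebraicGeometry.IsClosedImmersion ι) (hH : AlgebraicGeometry.IsIntegral H)
    (hloc : ∀ y : (Literature.AlgebraicGeometry.Motives.projectiveSpace n k).left,
      ∃ U : (Literature.AlgebraicGeometry.Motives.projectiveSpace n k).left.affineOpens,
        y ∈ (U : (Literature.AlgebraicGeometry.Motives.projectiveSpace n k).left.Opens) ∧ (ι.ker.ideal U).IsPrincipal)
    {h : H} (h1 : ¬ IsRegularLocalRing (H.presheaf.stalk h)) (h2 : ¬ IsClosed ({h} : Set H))
    (hno : ¬ ULTAt p k n H ι h) :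
    ¬ Summit.ResolutionOfSingularities.ResolutionOfSingularities.Theorems.EquisingularLiftNat p :=
  fun hE => hno (ult_of_equisingularLiftNat hE hp k n H ι hι hH hloc h h1 h2)

/-! ## The lower half of the sandwich: a horizontal regular centre through `x` at stage 0 gives `ULTAt` (v2, pure append) -/

/-- **Zero-step `ULTAt` (the lower half of the sandwich «LIFT ⇒ ULT»).** If for SOME characteristic-0 DVR `O` with a surjection
`π : O → k` and EVERY `φ, Y` as in the item there is an ideal sheaf `C` on `ℙⁿ_O` itself with `V(C)` regular, the point
`x := (ι ≫ Proj.map φ) h` in `supp C`, a generisation `c ⤳ x` in `supp C` off the special fibre (horizontality), special support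
inside `Y` (E1) and `supp C` off the generic points of `Y` — e.g. the ideal sheaf of an embedded regular lift of the curve
`closure {x}` — then `ULTAt p k n H ι h` holds with the EMPTY avoiding chain. Contrapositive: a `¬ ULTAt` witness has NO such centre
over ANY `O` (M-CENTRES.md §4 / ULT-STATUS.md §2: in particular no embedded lift of `Σ = closure {x}` over any DVR). [folklore] -/
theorem ultAt_of_horizontalCentre {p : ℕ} {k : Type} [Field k] [CharP k p] [IsAlgClosed k] {n : ℕ}
    {H : AlgebraicGeometry.Scheme.{0}} {ι : H ⟶ (Literature.AlgebraicGeometry.Motives.projectiveSpace n k).left} {h : H}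
    (hC : ∃ (O : Type) (_ : CommRing O) (_ : IsDomain O) (_ : IsDiscreteValuationRing O) (_ : CharZero O) (π : O →+* k),
      Function.Surjective π ∧ (letI := MvPolynomial.gradedAlgebra (σ := Fin (n + 1)) (R := O);
        letI := MvPolynomial.gradedAlgebra (σ := Fin (n + 1)) (R := k);
        ∀ (φ : MvPolynomial.homogeneousSubmodule (Fin (n + 1)) O →+*ᵍ MvPolynomial.homogeneousSubmodule (Fin (n + 1)) k)
          (hφ' : HomogeneousIdeal.irrelevant (MvPolynomial.homogeneousSubmodule (Fin (n + 1)) k) ≤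
            (HomogeneousIdeal.irrelevant (MvPolynomial.homogeneousSubmodule (Fin (n + 1)) O)).map φ),
          (∀ s, φ s = MvPolynomial.map π s) →
          ∀ Y : Set (AlgebraicGeometry.Proj (MvPolynomial.homogeneousSubmodule (Fin (n + 1)) O)),
            Y = Set.range (CategoryTheory.CategoryStruct.comp ι (AlgebraicGeometry.Proj.map φ hφ') : H ⟶ (AlgebraicGeometry.Proj (MvPolynomial.homogeneousSubmodule (Fin (n + 1)) O))) →
            ∃ C : (AlgebraicGeometry.Proj (MvPolynomial.homogeneousSubmodule (Fin (n + 1)) O)).IdealSheafData,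
              Literature.AlgebraicGeometry.Resolution.Scheme.IsRegular C.subscheme ∧
              ((CategoryTheory.CategoryStruct.comp ι (AlgebraicGeometry.Proj.map φ hφ') : H ⟶ (AlgebraicGeometry.Proj (MvPolynomial.homogeneousSubmodule (Fin (n + 1)) O))) h) ∈
                (C.support : Set (AlgebraicGeometry.Proj (MvPolynomial.homogeneousSubmodule (Fin (n + 1)) O))) ∧
              (∃ c : (AlgebraicGeometry.Proj (MvPolynomial.homogeneousSubmodule (Fin (n + 1)) O)), c ∈ (C.support : Set (AlgebraicGeometry.Proj (MvPolynomial.homogeneousSubmodule (Fin (n + 1)) O))) ∧ c ∉ (CategoryTheory.CategoryStruct.comp (AlgebraicGeometry.Proj.toSpecZero (MvPolynomial.homogeneousSubmodule (Fin (n + 1)) O)) (AlgebraicGeometry.Spec.map (CommRingCat.ofHom (algebraMap O (MvPolynomial.homogeneousSubmodule (Fin (n + 1)) O 0))))) ⁻¹' {IsLocalRing.closedPoint O} ∧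
                c ⤳ ((CategoryTheory.CategoryStruct.comp ι (AlgebraicGeometry.Proj.map φ hφ') : H ⟶ (AlgebraicGeometry.Proj (MvPolynomial.homogeneousSubmodule (Fin (n + 1)) O))) h)) ∧
              (C.support : Set (AlgebraicGeometry.Proj (MvPolynomial.homogeneousSubmodule (Fin (n + 1)) O))) ∩ (CategoryTheory.CategoryStruct.comp (AlgebraicGeometry.Proj.toSpecZero (MvPolynomial.homogeneousSubmodule (Fin (n + 1)) O)) (AlgebraicGeometry.Spec.map (CommRingCat.ofHom (algebraMap O (MvPolynomial.homogeneousSubmodule (Fin (n + 1)) O 0))))) ⁻¹' {IsLocalRing.closedPoint O} ⊆ Y ∧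
              (C.support : Set (AlgebraicGeometry.Proj (MvPolynomial.homogeneousSubmodule (Fin (n + 1)) O))) ⊆ {y | ¬ IsGenericPoint y Y})) :
    ULTAt p k n H ι h := by
  obtain ⟨O, i1, i2, i3, i4, π, hπ, h'⟩ := hC
  refine ⟨O, i1, i2, i3, i4, π, hπ, ?_⟩
  intro φ hφ' hφ Y hY
  obtain ⟨C, hCreg, hxC, ⟨c, hc, hcF, hcx⟩, hE1, hgen⟩ := h' φ hφ' hφ Y hY
  refine ⟨_, CategoryTheory.CategoryStruct.id _, Y, fun Q h0 _ => h0, C, hCreg, ⟨_, hxC, by simp, c, hc, ?_, hcx⟩, ?_, ?_⟩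
  · simpa using hcF
  · intro y hy
    exact subset_closure (hE1 ⟨hy.1, by simpa using hy.2⟩)
  · rintro _ ⟨y, hy, rfl⟩
    simpa using hgen hy

end Summit.ResolutionOfSingularities.ResolutionOfSingularities.Cruxes.EquisingularLiftNat.Sections
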